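import Summits.BirchSwinnertonDyer.BirchSwinnertonDyer.Theorems.OneSidedTwistSqueezeX9KatoDivisibilityX9StubTestCocyclePkLevelX9Core
import Literature.NumberTheory.EllipticCurves.SelmerInftyTorsionFiniteProofs
import HarnessLib

/-!
# Crux `KatoDivisibilityX9` (stmt-BirchSwinnertonDyer-20547), line `graded_euler_loss`, stub
# `stub_testCocyclePkLevelX9` (g6), part 5: the DEFECT CALCULUS for coordinate cocycles at the
# place above `p`

Seat `bsd-line-k6-p4` (prover-bsd-line-k6-p4-g6-0, stub worker 1a′).  THEOREMS ONLY (no definition,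
no named fact, no `sorry`); `--supports stmt-BirchSwinnertonDyer-20547` helper; closes nothing.

Setting (generic): a topological group `G`, a normal subgroup `H` (intended `Γ_∞ = ker κ`), a
subgroup `D∞ ≤ H` (intended `D_v ∩ Γ_∞`) normalised by an element `d` (a local lift of the
topological generator), discrete `G`-modules `S` (intended `E[p^k]`) and `M` (intended `E[p^∞]`) with
an equivariant additive map `ι : S → M`.  A cocycle `f ∈ Z¹(H, S)` is *principal over `M` on `D∞`
with root `a`* if `ι (f u) = u•a − a` for `u ∈ D∞`.

* §1 `iterate_natCard_eq_zero_of_iterate_eq_zero` — an endomorphism `φ` of a FINITE additive group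
  with `φ^[n] q = 0` for some `n` already has `φ^[#Q] q = 0`.
* §2 cocycle identities: `(u₀·f)(n) = f n + (n•f u₀ − f u₀)` for `u₀ ∈ H`
  (`conjCocycle_apply_of_mem`), hence `((d u₀)·f)(n) = (d·f)(n) + ∂(d • f u₀)(n)`
  (`conjCocycle_mul_apply_of_mem`).
* §3 roots: the root of `(d u₀)·f − f` built from a root `a` of `f` is `d•a + ι(d • f u₀) − a`
  (`root_conj_sub`); `n • root ∈ M^{D∞}` when `n S = 0`; two roots differ by a `D∞`-fixed element;
  a root congruent to a fixed element modulo `M[n] = ι S` makes `f` principal over `S`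
  (`principal_of_root`); and the RECURSION along a family `e_i = γ·e_{i+1} − e_{i+1}`,
  `γ = d u₀`: roots `a_j` of `e_{L−1−j}` with `n • a_j = (d − 1)^j (n • a_0)` (`exists_root_iterate`).
* §4 the elliptic input: for `M = E[p^∞]`, `B = M^{D∞}`, the group `B / p^k B` is FINITE
  (pigeonhole `ResKernel.finite_quotient_range_of_finite_ker` over the pieces `B[p^m] ⊆ E[p^m]`), so
  there is `N₀` (its order) such that `(d−1)^[L] x ∈ p^k B` for SOME `L` forces
  `(d−1)^[j] x ∈ p^k B` for ALL `j ≥ N₀` (`exists_defectBound`).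

References: J.-P. Serre, *Galois Cohomology* (1997) I §2.5, I §5.1 [SerreGaloisCohomology1997];
R. Greenberg, LNM 1716 (1999) §3 proof of Lemma 3.1 [GreenbergLNM1716].
-/

set_option autoImplicit false
-- the summit and its single problem are both named `BirchSwinnertonDyer` (registry layout D-0017)
set_option linter.dupNamespace false

noncomputable section

open scoped ContRepresentation
open Field Literature.NumberTheory.GaloisRepresentations Literature.NumberTheory.EllipticCurves
open WeierstrassCurve (geomTorsion geomPrimaryTorsion geomPoints)

universe u

namespace Summit.BirchSwinnertonDyer.BirchSwinnertonDyer.Theorems.OneSidedTwistSqueezeX9KatoDivisibilityX9StubTestCocyclePkLevelX9Defect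

/-! ## §1 Nilpotence for free on a finite group -/

section Finite

variable {Q : Type*} [AddCommGroup Q] [Finite Q]

/-- **An endomorphism of a finite additive group that kills `q` after SOME number of steps kills it
after `#Q` steps**: among `q, φ q, …, φ^{#Q} q` two terms coincide, so the orbit is eventually
periodic; a periodic orbit that reaches `0` is `0` from the start of the period. [folklore] -/
theorem iterate_natCard_eq_zero_of_iterate_eq_zero (φ : Q →+ Q) {n : ℕ} {q : Q}
    (h : (⇑φ)^[n] q = 0) : (⇑φ)^[Nat.card Q] q = 0 := by
  classical
  haveI := Fintype.ofFinite Q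
  -- pigeonhole among `φ^[0] q, …, φ^[#Q] q`
  have hcard : Fintype.card Q < Fintype.card (Fin (Nat.card Q + 1)) := by
    rw [Fintype.card_fin, ← Nat.card_eq_fintype_card]
    exact Nat.lt_succ_self _
  obtain ⟨a, b, hab, heq⟩ :=
    Fintype.exists_ne_map_eq_of_card_lt (fun m : Fin (Nat.card Q + 1) => (⇑φ)^[(m : ℕ)] q) hcard
  -- periodicity from the smaller index
  have key : ∀ {a b : ℕ}, a < b → (⇑φ)^[a] q = (⇑φ)^[b] q → (⇑φ)^[a] q = 0 := by
    intro a b hlt hab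
    obtain ⟨per, rfl⟩ := Nat.exists_eq_add_of_lt hlt
    have hper : ∀ t : ℕ, (⇑φ)^[a + (per + 1) * t] q = (⇑φ)^[a] q := by
      intro t
      induction t with
      | zero => rw [mul_zero, add_zero]
      | succ t ih =>
        rw [show a + (per + 1) * (t + 1) = (per + 1) * t + (a + per + 1) by ring,
          Function.iterate_add_apply, ← hab, ← Function.iterate_add_apply,
          show (per + 1) * t + a = a + (per + 1) * t by ring, ih]
    rw [← hper n]
    obtain ⟨r, hr⟩ : ∃ r, a + (per + 1) * n = r + n := ⟨a + per * n, by ring⟩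
    rw [hr, Function.iterate_add_apply, h, iterate_map_zero]
  have hne : (a : ℕ) ≠ b := fun h' => hab (Fin.ext h')
  rcases Nat.lt_or_gt_of_ne hne with hlt | hlt
  · have ha : (⇑φ)^[(a : ℕ)] q = 0 := key hlt heq
    obtain ⟨r, hr⟩ := Nat.exists_eq_add_of_le (show (a : ℕ) ≤ Nat.card Q by omega)
    rw [hr, add_comm, Function.iterate_add_apply, ha, iterate_map_zero]
  · have hb : (⇑φ)^[(b : ℕ)] q = 0 := key hlt heq.symm
    obtain ⟨r, hr⟩ := Nat.exists_eq_add_of_le (show (b : ℕ) ≤ Nat.card Q by omega)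
    rw [hr, add_comm, Function.iterate_add_apply, hb, iterate_map_zero]

/-- Corollary: under the same hypothesis `φ^[j] q = 0` for every `j ≥ #Q`. [folklore] -/
theorem iterate_eq_zero_of_natCard_le (φ : Q →+ Q) {n : ℕ} {q : Q} (h : (⇑φ)^[n] q = 0)
    {j : ℕ} (hj : Nat.card Q ≤ j) : (⇑φ)^[j] q = 0 := by
  obtain ⟨r, rfl⟩ := Nat.exists_eq_add_of_le hj
  rw [add_comm, Function.iterate_add_apply, iterate_natCard_eq_zero_of_iterate_eq_zero φ h,
    iterate_map_zero]

end Finite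

/-! ## §2 Cocycle identities for the conjugation action -/

section Cocycle

variable {G : Type u} [Group G] [TopologicalSpace G] [IsTopologicalGroup G]
  (H : Subgroup G) [H.Normal]
  {S : Type u} [AddCommGroup S] [DistribMulAction G S] [TopologicalSpace S] [DiscreteTopology S]

/-- **Conjugation by an element of `H` is a coboundary away from the identity, on the nose**: for
`u₀ ∈ H` and `f ∈ Z¹(H, S)`, `(u₀·f)(n) = u₀ • f(u₀⁻¹ n u₀) = f n + (n • f u₀ − f u₀)`.
[cite: SerreGaloisCohomology1997, I §2.5] -/
theorem conjCocycle_apply_of_mem (f : contOneCocycles (discreteTopRep H S)) {u₀ : G} (hu₀ : u₀ ∈ H)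
    (n : H) :
    (conjCocycle H u₀ f).1 n = f.1 n + ((n : G) • f.1 ⟨u₀, hu₀⟩ - f.1 ⟨u₀, hu₀⟩) := by
  rw [conjCocycle_apply]
  have hconj : subgroupConj H u₀ n = ⟨u₀, hu₀⟩⁻¹ * (n * ⟨u₀, hu₀⟩) :=
    Subtype.ext (by simp [mul_assoc])
  rw [hconj, cocycle_mul' f, cocycle_inv' f, cocycle_mul' f]
  change u₀ • (-(u₀⁻¹ • f.1 ⟨u₀, hu₀⟩) + u₀⁻¹ • (f.1 n + (n : G) • f.1 ⟨u₀, hu₀⟩)) = _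
  rw [smul_add, smul_neg, smul_smul, smul_smul, mul_inv_cancel, one_smul, one_smul]
  abel

/-- **`(d u₀)·f = d·f + ∂(d • f u₀)` on the nose** for `u₀ ∈ H`: `((d u₀)·f)(n) = (d·f)(n) +
(n • (d • f u₀) − d • f u₀)`. [cite: SerreGaloisCohomology1997, I §2.5] -/
theorem conjCocycle_mul_apply_of_mem (f : contOneCocycles (discreteTopRep H S)) (d : G) {u₀ : G}
    (hu₀ : u₀ ∈ H) (n : H) :
    (conjCocycle H (d * u₀) f).1 n =
      (conjCocycle H d f).1 n + ((n : G) • (d • f.1 ⟨u₀, hu₀⟩) - d • f.1 ⟨u₀, hu₀⟩) := by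
  have hconj : subgroupConj H (d * u₀) n = subgroupConj H u₀ (subgroupConj H d n) :=
    Subtype.ext (by simp [mul_assoc])
  rw [conjCocycle_apply, hconj, mul_smul, ← conjCocycle_apply H u₀ f, conjCocycle_apply_of_mem H f hu₀,
    smul_add, ← conjCocycle_apply H d f, subgroupConj_apply_coe, smul_sub, smul_smul,
    show d * (d⁻¹ * (n : G) * d) = (n : G) * d by group, mul_smul]

end Cocycle

/-! ## §3 Roots of cocycles principal over a bigger module on a subgroup -/

section Root

variable {G : Type u} [Group G] [TopologicalSpace G] [IsTopologicalGroup G]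
  (H : Subgroup G) [H.Normal] (D : Subgroup G) (hDH : D ≤ H)
  {S : Type u} [AddCommGroup S] [DistribMulAction G S] [TopologicalSpace S] [DiscreteTopology S]
  {M : Type u} [AddCommGroup M] [DistribMulAction G M]
  (ι : S →+ M) (hι : ∀ (g : G) (s : S), ι (g • s) = g • ι s)

include hι in
/-- **The root of `γ·f − f`**: if `ι (f u) = u•a − a` on `D∞` and `γ = d u₀` with `u₀ ∈ H`, `d`
normalising `D∞`, then `γ·f − f` has the root `d•a + ι(d • f u₀) − a` on `D∞`.
[cite: SerreGaloisCohomology1997, I §2.5] -/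
theorem root_conj_sub (f : contOneCocycles (discreteTopRep H S)) {d u₀ : G} (hu₀ : u₀ ∈ H)
    (hd : ∀ u ∈ D, d⁻¹ * u * d ∈ D) {a : M}
    (ha : ∀ (u : G) (hu : u ∈ D), ι (f.1 ⟨u, hDH hu⟩) = u • a - a) (u : G) (hu : u ∈ D) :
    ι ((conjCocycle H (d * u₀) f - f).1 ⟨u, hDH hu⟩) =
      u • (d • a + ι (d • f.1 ⟨u₀, hu₀⟩) - a) - (d • a + ι (d • f.1 ⟨u₀, hu₀⟩) - a) := by
  have hconj : (subgroupConj H d ⟨u, hDH hu⟩ : H) = ⟨d⁻¹ * u * d, hDH (hd u hu)⟩ :=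
    Subtype.ext (subgroupConj_apply_coe H d _)
  have hval : (conjCocycle H (d * u₀) f - f).1 ⟨u, hDH hu⟩ =
      d • f.1 ⟨d⁻¹ * u * d, hDH (hd u hu)⟩ + (u • (d • f.1 ⟨u₀, hu₀⟩) - d • f.1 ⟨u₀, hu₀⟩) -
        f.1 ⟨u, hDH hu⟩ := by
    rw [sub_apply_val, conjCocycle_mul_apply_of_mem H f d hu₀, conjCocycle_apply, hconj]
  rw [hval, map_sub, map_add, map_sub, hι, hι, hι, ha _ (hd u hu), ha u hu, smul_sub, smul_smul,
    show d * (d⁻¹ * u * d) = u * d by group, mul_smul, smul_sub, smul_add]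
  abel

omit [IsTopologicalGroup G] [H.Normal] in
/-- If `ι (f u) = u•a − a` on `D∞` and `n` kills `S`, then `n • a` is `D∞`-fixed.
[cite: SerreGaloisCohomology1997, I §5.1] -/
theorem smul_nsmul_root_eq (f : contOneCocycles (discreteTopRep H S)) {n : ℕ}
    (hn : ∀ s : S, n • s = 0) {a : M}
    (ha : ∀ (u : G) (hu : u ∈ D), ι (f.1 ⟨u, hDH hu⟩) = u • a - a) (u : G) (hu : u ∈ D) :
    u • (n • a) = n • a := by
  rw [← sub_eq_zero, smul_comm, ← smul_sub, ← ha u hu, ← map_nsmul, hn, map_zero]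

omit [IsTopologicalGroup G] [H.Normal] in
/-- Two roots of the same cocycle on `D∞` differ by a `D∞`-fixed element.
[cite: SerreGaloisCohomology1997, I §5.1] -/
theorem smul_sub_root_eq (f : contOneCocycles (discreteTopRep H S)) {a a' : M}
    (ha : ∀ (u : G) (hu : u ∈ D), ι (f.1 ⟨u, hDH hu⟩) = u • a - a)
    (ha' : ∀ (u : G) (hu : u ∈ D), ι (f.1 ⟨u, hDH hu⟩) = u • a' - a') (u : G) (hu : u ∈ D) :
    u • (a - a') = a - a' := by
  have h := (ha u hu).symm.trans (ha' u hu)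
  rw [smul_sub]
  exact sub_eq_sub_iff_sub_eq_sub.mp h

omit [IsTopologicalGroup G] [H.Normal] in
include hι in
/-- **From a root congruent to a fixed element to principality over `S`**: if `ι (f u) = u•a − a` on
`D∞`, `β` is `D∞`-fixed with `n•a = n•β`, the `n`-torsion of `M` lies in `ι(S)` and `ι` is
injective, then `f u = u•x − x` on `D∞` for some `x ∈ S` (namely `ι x = a − β`).
[cite: SerreGaloisCohomology1997, I §5.1] -/
theorem principal_of_root (hinj : Function.Injective ι) {n : ℕ}
    (htor : ∀ m : M, n • m = 0 → ∃ s : S, ι s = m)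
    (f : contOneCocycles (discreteTopRep H S)) {a β : M}
    (ha : ∀ (u : G) (hu : u ∈ D), ι (f.1 ⟨u, hDH hu⟩) = u • a - a)
    (hβ : ∀ u ∈ D, u • β = β) (hn : n • a = n • β) :
    ∃ x : S, ∀ (u : G) (hu : u ∈ D), f.1 ⟨u, hDH hu⟩ = u • x - x := by
  obtain ⟨x, hx⟩ := htor (a - β) (by rw [smul_sub, hn, sub_self])
  refine ⟨x, fun u hu => hinj ?_⟩
  rw [ha u hu, map_sub, hι, hx, smul_sub, hβ u hu]
  abel

include hι in
/-- **The recursion of roots along `e_i = γ·e_{i+1} − e_{i+1}`** (`γ = d u₀`, `u₀ ∈ H`, `d`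
normalising `D∞`, `n S = 0`): from a root `a₀` of the top cocycle `e_{L−1}` on `D∞` one gets, for
every `j < L`, a root `a_j` of `e_{L−1−j}` with `n • a_j = (d−1)^[j] (n • a₀)`.
[cite: SerreGaloisCohomology1997, I §2.5] -/
theorem exists_root_iterate {L : ℕ} (hL : 0 < L)
    (e : Fin L → contOneCocycles (discreteTopRep H S)) {d u₀ : G} (hu₀ : u₀ ∈ H)
    (hd : ∀ u ∈ D, d⁻¹ * u * d ∈ D) {n : ℕ} (hn : ∀ s : S, n • s = 0)
    (he : ∀ (i : Fin L) (hi : (i : ℕ) + 1 < L),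
      e i = conjCocycle H (d * u₀) (e ⟨(i : ℕ) + 1, hi⟩) - e ⟨(i : ℕ) + 1, hi⟩)
    {a₀ : M} (ha₀ : ∀ (u : G) (hu : u ∈ D), ι ((e ⟨L - 1, by omega⟩).1 ⟨u, hDH hu⟩) = u • a₀ - a₀)
    (j : ℕ) (hj : j < L) :
    ∃ a : M, (∀ (u : G) (hu : u ∈ D), ι ((e ⟨L - 1 - j, by omega⟩).1 ⟨u, hDH hu⟩) = u • a - a) ∧
      n • a = (fun m : M => d • m - m)^[j] (n • a₀) := by
  induction j with
  | zero => exact ⟨a₀, ha₀, rfl⟩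
  | succ j ih =>
    obtain ⟨a, ha, hna⟩ := ih (by omega)
    have hlt : L - 1 - (j + 1) < L := by omega
    have hi : ((⟨L - 1 - (j + 1), hlt⟩ : Fin L) : ℕ) + 1 < L := by simp; omega
    have hidx : (⟨((⟨L - 1 - (j + 1), hlt⟩ : Fin L) : ℕ) + 1, hi⟩ : Fin L) = ⟨L - 1 - j, by omega⟩ :=
      Fin.ext (by simp; omega)
    have key := he ⟨L - 1 - (j + 1), hlt⟩ hi
    rw [hidx] at key
    refine ⟨d • a + ι (d • (e ⟨L - 1 - j, by omega⟩).1 ⟨u₀, hu₀⟩) - a, fun u hu => ?_, ?_⟩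
    · rw [key]
      exact root_conj_sub H D hDH ι hι _ hu₀ hd ha u hu
    · rw [Function.iterate_succ_apply', ← hna, smul_sub, smul_add, smul_comm, ← map_nsmul, hn,
        map_zero, add_zero]

include hι in
/-- The step beyond the family: the cocycle `γ·e_0 − e_0` has a root `a` on `D∞` with
`n • a = (d−1)^[L] (n • a₀)`. [cite: SerreGaloisCohomology1997, I §2.5] -/
theorem exists_root_beyond {L : ℕ} (hL : 0 < L)
    (e : Fin L → contOneCocycles (discreteTopRep H S)) {d u₀ : G} (hu₀ : u₀ ∈ H)
    (hd : ∀ u ∈ D, d⁻¹ * u * d ∈ D) {n : ℕ} (hn : ∀ s : S, n • s = 0)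
    (he : ∀ (i : Fin L) (hi : (i : ℕ) + 1 < L),
      e i = conjCocycle H (d * u₀) (e ⟨(i : ℕ) + 1, hi⟩) - e ⟨(i : ℕ) + 1, hi⟩)
    {a₀ : M} (ha₀ : ∀ (u : G) (hu : u ∈ D), ι ((e ⟨L - 1, by omega⟩).1 ⟨u, hDH hu⟩) = u • a₀ - a₀) :
    ∃ a : M, (∀ (u : G) (hu : u ∈ D),
        ι ((conjCocycle H (d * u₀) (e ⟨0, hL⟩) - e ⟨0, hL⟩).1 ⟨u, hDH hu⟩) = u • a - a) ∧
      n • a = (fun m : M => d • m - m)^[L] (n • a₀) := by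
  obtain ⟨a, ha, hna⟩ := exists_root_iterate H D hDH ι hι hL e hu₀ hd hn he ha₀ (L - 1) (by omega)
  have hidx : (⟨L - 1 - (L - 1), (by omega : L - 1 - (L - 1) < L)⟩ : Fin L) = ⟨0, hL⟩ :=
    Fin.ext (by simp)
  rw [hidx] at ha
  refine ⟨d • a + ι (d • (e ⟨0, hL⟩).1 ⟨u₀, hu₀⟩) - a, fun u hu =>
    root_conj_sub H D hDH ι hι _ hu₀ hd ha u hu, ?_⟩
  have hiter : ∀ m : M, (fun m : M => d • m - m)^[L] m =
      d • (fun m : M => d • m - m)^[L - 1] m - (fun m : M => d • m - m)^[L - 1] m := by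
    intro m
    conv_lhs => rw [show L = L - 1 + 1 by omega, Function.iterate_succ_apply']
  rw [hiter, ← hna, smul_sub, smul_add, smul_comm, ← map_nsmul, hn, map_zero, add_zero]

end Root

/-! ## §4 The elliptic input: `E[p^∞]^{D∞} / p^k` is finite, and the defect bound `N₀` -/

section Curve

variable {K : Type u} [Field K] (W : WeierstrassCurve K) [W.IsElliptic] (p : ℕ) [Fact p.Prime]
  (k : ℕ) (D : Subgroup (absoluteGaloisGroup K))

/-- **The defect bound.**  Let `B = E[p^∞]^{D∞}` (the points fixed by `D∞`) and let `d ∈ Γ_K`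
normalise `D∞`, so that `θ = d − 1` acts on `B` and on the FINITE group `Q = B / p^k B`
(finite: `p^k •` has kernel `B[p^k] ⊆ E[p^k]` and `B = ⋃ B[p^m]` with finite pieces — the
pigeonhole `ResKernel.finite_quotient_range_of_finite_ker`, as in Greenberg's proof of Lemma 3.1).
Then there is `N₀` (`= #Q`) such that for every `x ∈ B`: if `θ^[L] x ∈ p^k B` for SOME `L` then
`θ^[j] x ∈ p^k B` for EVERY `j ≥ N₀`. [cite: GreenbergLNM1716, §3 Lemma 3.1 (proof)] -/
theorem exists_defectBound {d : absoluteGaloisGroup K} (hd : ∀ u ∈ D, d⁻¹ * u * d ∈ D) :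
    ∃ N₀ : ℕ, ∀ x : geomPrimaryTorsion W p, (∀ u ∈ D, u • x = x) →
      (∃ (L : ℕ) (β : geomPrimaryTorsion W p), (∀ u ∈ D, u • β = β) ∧
        (fun m : geomPrimaryTorsion W p => d • m - m)^[L] x = p ^ k • β) →
      ∀ j : ℕ, N₀ ≤ j → ∃ β : geomPrimaryTorsion W p, (∀ u ∈ D, u • β = β) ∧
        (fun m : geomPrimaryTorsion W p => d • m - m)^[j] x = p ^ k • β := by
  -- the fixed points `B`
  let B : AddSubgroup (geomPrimaryTorsion W p) :=
    { carrier := {x | ∀ u ∈ D, u • x = x}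
      add_mem' := fun {x y} hx hy u hu => by rw [smul_add, hx u hu, hy u hu]
      zero_mem' := fun u _ => smul_zero u
      neg_mem' := fun {x} hx u hu => by rw [smul_neg, hx u hu] }
  have hmemB : ∀ {x}, x ∈ B ↔ ∀ u ∈ D, u • x = x := fun {x} => Iff.rfl
  -- multiplication by `p^k` on `B` and the finite quotient `Q = B / p^k B`
  let mulp : B →+ B := DistribSMul.toAddMonoidHom B (p ^ k : ℕ)
  have hmulp : ∀ b : B, mulp b = p ^ k • b := fun _ => rfl
  haveI hfinQ : Finite (B ⧸ mulp.range) := by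
    haveI : Finite mulp.ker := by
      haveI := W.finite_torsionBy_geomPrimaryTorsion p k
      refine Finite.of_injective (fun b => (⟨((b : B) : geomPrimaryTorsion W p), ?_⟩ :
        AddSubgroup.torsionBy (geomPrimaryTorsion W p) ((p ^ k : ℕ) : ℤ))) ?_
      · rw [AddSubgroup.torsionBy.nsmul_iff]
        have := (AddMonoidHom.mem_ker).mp b.2
        exact congrArg (fun z : B => (z : geomPrimaryTorsion W p)) this
      · intro a b hab
        apply Subtype.ext; apply Subtype.ext
        exact congrArg (fun z : AddSubgroup.torsionBy (geomPrimaryTorsion W p) ((p ^ k : ℕ) : ℤ) => (z : geomPrimaryTorsion W p)) hab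
    refine (ResKernel.finite_quotient_range_of_finite_ker mulp
      (fun m => AddSubgroup.torsionBy _ ((p ^ m : ℕ) : ℤ)) (fun m m' hmm' => ?_) (fun b => ?_) (fun m => ?_)
      (fun m b hb => ?_)).1
    · intro b hb
      rw [AddSubgroup.torsionBy.nsmul_iff] at hb ⊢
      obtain ⟨c, hc⟩ := Nat.pow_dvd_pow p hmm'
      rw [hc, Nat.mul_comm (p ^ m) c, ← smul_smul, hb, smul_zero]
    · obtain ⟨m, hm⟩ := ((b : B) : geomPrimaryTorsion W p).2
      refine ⟨m, ?_⟩
      rw [AddSubgroup.torsionBy.nsmul_iff]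
      apply Subtype.ext; apply Subtype.ext
      simpa using hm
    · haveI := W.finite_torsionBy_geomPrimaryTorsion p m
      refine Finite.of_injective (fun b => (⟨((b : B) : geomPrimaryTorsion W p), ?_⟩ :
        AddSubgroup.torsionBy (geomPrimaryTorsion W p) ((p ^ m : ℕ) : ℤ))) ?_
      · have hb := AddSubgroup.torsionBy.nsmul_iff.mp b.2
        rw [AddSubgroup.torsionBy.nsmul_iff]
        exact congrArg (fun z : B => (z : geomPrimaryTorsion W p)) hb
      · intro a b hab
        apply Subtype.ext; apply Subtype.ext
        exact congrArg (fun z : AddSubgroup.torsionBy (geomPrimaryTorsion W p) ((p ^ m : ℕ) : ℤ) => (z : geomPrimaryTorsion W p)) hab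
    · rw [AddSubgroup.torsionBy.nsmul_iff] at hb ⊢
      rw [← map_nsmul, hb, map_zero]
  -- `θ = d − 1` on `B` and on `Q`
  have hdmem : ∀ x : B, d • (x : geomPrimaryTorsion W p) ∈ B := fun x u hu => by
    rw [show u • d • (x : geomPrimaryTorsion W p) = d • ((d⁻¹ * u * d) • (x : geomPrimaryTorsion W p)) by
      rw [smul_smul, smul_smul, show d * (d⁻¹ * u * d) = u * d by group], x.2 _ (hd u hu)]
  let Θ : B →+ B :=
    { toFun := fun x => ⟨d • (x : geomPrimaryTorsion W p) - x, B.sub_mem (hdmem x) x.2⟩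
      map_zero' := Subtype.ext (by simp)
      map_add' := fun x y => Subtype.ext (by
        simp only [AddSubgroup.coe_add, smul_add]
        abel) }
  have hΘ : ∀ x : B, ((Θ x : B) : geomPrimaryTorsion W p) = d • (x : geomPrimaryTorsion W p) - x :=
    fun _ => rfl
  have hΘ_iter : ∀ (j : ℕ) (x : B), ((Θ^[j] x : B) : geomPrimaryTorsion W p) =
      (fun m : geomPrimaryTorsion W p => d • m - m)^[j] (x : geomPrimaryTorsion W p) := by
    intro j
    induction j with
    | zero => intro x; rfl
    | succ j ih => intro x; rw [Function.iterate_succ_apply', Function.iterate_succ_apply', hΘ, ih]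
  have hle : mulp.range ≤ mulp.range.comap Θ := by
    rintro _ ⟨x, rfl⟩
    refine ⟨Θ x, Subtype.ext ?_⟩
    rw [hmulp, hmulp, hΘ, AddSubgroupClass.coe_nsmul, AddSubgroupClass.coe_nsmul, hΘ, smul_sub,
      smul_comm]
  let Θbar : B ⧸ mulp.range →+ B ⧸ mulp.range := QuotientAddGroup.map mulp.range mulp.range Θ hle
  have hΘbar_iter : ∀ (j : ℕ) (x : B), Θbar^[j] (QuotientAddGroup.mk' mulp.range x) =
      QuotientAddGroup.mk' mulp.range (Θ^[j] x) := by
    intro j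
    induction j with
    | zero => intro x; rfl
    | succ j ih =>
      intro x
      rw [Function.iterate_succ_apply', Function.iterate_succ_apply', ih]
      rfl
  -- membership in `p^k B` read in `E[p^∞]`
  have hmem_range : ∀ x : B, (QuotientAddGroup.mk' mulp.range x = 0 ↔
      ∃ β : geomPrimaryTorsion W p, (∀ u ∈ D, u • β = β) ∧
        (x : geomPrimaryTorsion W p) = p ^ k • β) := by
    intro x
    rw [QuotientAddGroup.mk'_apply, QuotientAddGroup.eq_zero_iff]
    constructor
    · rintro ⟨β, hβ⟩
      exact ⟨β, β.2, by rw [← hβ, hmulp, AddSubgroupClass.coe_nsmul]⟩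
    · rintro ⟨β, hβ, hx⟩
      exact ⟨⟨β, hβ⟩, Subtype.ext (by rw [hmulp, AddSubgroupClass.coe_nsmul, hx])⟩
  refine ⟨Nat.card (B ⧸ mulp.range), fun x hx hL j hj => ?_⟩
  obtain ⟨L, β, hβ, hLx⟩ := hL
  have hxB : x ∈ B := hx
  -- `Θbar^[L] [x] = 0`
  have hL0 : Θbar^[L] (QuotientAddGroup.mk' mulp.range ⟨x, hxB⟩) = 0 := by
    rw [hΘbar_iter, hmem_range]
    exact ⟨β, hβ, by rw [hΘ_iter, hLx]⟩
  have hj0 := iterate_eq_zero_of_natCard_le Θbar hL0 hj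
  rw [hΘbar_iter, hmem_range] at hj0
  obtain ⟨β', hβ', hj'⟩ := hj0
  exact ⟨β', hβ', (hΘ_iter j ⟨x, hxB⟩).symm.trans hj'⟩

end Curve

end Summit.BirchSwinnertonDyer.BirchSwinnertonDyer.Theorems.OneSidedTwistSqueezeX9KatoDivisibilityX9StubTestCocyclePkLevelX9Defect

end
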